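/-
Copyright: the b2b-balaban cell (near-miss cell 7), T⁴-continuum CRUX team (coordinator ruling e34b3e0c item (2)),
seat t4-ne7b-formalise-leaf-04 (gen 26), as the §3 complement of seat t4-ne7b-formalise-leaf-05 (gen 26)'s
`Spine/NE7b/HealingMapClassRemainder` (p255819), on the NE7b crux refuter's PRICING-NE7b v6 F28 ∕ F29 ∕ F32
(seat `t4-ne7b-refuter` gen 6). Released under the licence of the surrounding project.
-/
import Summits.QuantumFields.BalabanUV.T4Continuum.Spine.NE7b.HealingMapClassRemainder

/-!
# Healing with an additive remainder: the COMPONENT-indexed instantiation (F29) and the generic summable END (F32)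
# (route NE7b R-H; sibling of `HealingMapClassRemainder`)

Cell `pub-balaban`, sub-cell `t4`, spine estimate NE7b (node U5c), candidate route R-H «Peierls healing map».  The
sibling `…NE7b.HealingMapClass` module `HealingMapClassRemainder` (lineage leaf-05) lands the refuter's v6 F28 re-cut:
set-valued healing laws whose pointwise comparison carries an additive remainder `rem K t τ` indexed by the bad TERM
and budgeted ONCE over the bad class (`HealingLawsSetR`, `sum_rem_le : Σ_{τ ∈ Bad K t} rem K t τ ≤ ρ K·Σ_{T K} A`), with
the ENDs `relWeightBound_of_healingSetR` ∕ `exists_relWeightBound_of_healingSetR_majorant` ∕ `…_countFibred`.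

THIS FILE adds the two corollaries the refuter's v6 text consumes and that module does not state:
* §3a **`HealingLawsSetR.of_indexed`** — PRICING-NE7b v6 F29's instantiation sentence for the M2 owner is indexed by
  the PINNED COMPONENT: «`R K t x τ :=` the part of the bad term's weight carried by the exterior REST event `G^c(x)`»,
  with the budget arriving summed over the cover, `Σ_{x ∈ X K} Σ_{τ ∈ Badx K x} R K t x τ ≤ ρ K·Σ_{τ ∈ T K} A K t τ`
  (`weight(G^c(x))` bounded by (LD-G), summed over the pinned components).  For NON-NEGATIVE `R` this inhabits
  `HealingLawsSetR` with the COLLECTED term-indexed remainder `rem K t τ := Σ_{x ∈ X K, τ ∈ Badx K x} R K t x τ`: the law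
  survives because the collected remainder dominates each `R K t x τ` (`Finset.single_le_sum`), and the budget is the
  displayed one after exchanging the two sums (`sum_collect_le`).  The converse does not hold (a term-indexed remainder
  re-read per component pays the cover's multiplicity), so `HealingLawsSetR` is the weaker hypothesis and every END of
  the sibling applies verbatim to the component-indexed data.
* §3b **`exists_relWeightBound_of_healingSetR_summable`** — v6 F32's generic END: two runs' `HealingLawsSetR` + ONE
  summable `W` dominating both total tolerances `Σ_x q K x + ρ K` at every cutoff ⟹ `W K → 0`, hence `W K < 1` from some
  `K₀` on, and `relWeightBound_of_healingSetR` gives `∃ K₀, T4WeightBudget.RelWeightBound …` (no two-rate shape asked).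

HONEST FRAMING. [folklore] finite-sum bookkeeping (one `Finset.sum_comm`, one `Summable.tendsto_atTop_zero`); F29's
reading of the remainder and the large-deviation bound (LD-G) behind `ρ` are DISPLAYED hypotheses of the caller, never
asserted here; nothing of [Bałaban 1983–89] is asserted or cited; no `def`, no `def … : Prop` fact, no `[cite:]`.
(MP<L²) OPEN; R-H KEEP-AS-CANDIDATE ∕ R-P1 KEEP are the refuter's grades, unchanged by bookkeeping.  BY-NAME EFFECT ON
THE WALL (`WALL-NE7b-P1.md` §2): NONE.  NE7b (`T4WeightBudget.RelWeightBound`) NOT PRINTED, NOT PROVED; spine PROVED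
0∕9; rung (B)+1 on a FINITE torus T⁴ — NOT infinite volume, NOT the mass gap, NOT Clay.  HONEST DEPENDENCY: continuum
YM on T⁴ ⇐ BetaPertH ∧ nine spine estimates (0/9 proved); BetaPertH ⇐ (D1) ∧ (D4) ∧ CAP+tail; G-an2-4 gates asym, D1
and NE2/3/4.  POLICY (ruling e34b3e0c): crux-route work of item (2) under `Spine/NE7b/`, NOT a `T4Continuum/Support`
leaf.
-/

set_option autoImplicit false

open Finset
open Literature.MathematicalPhysics.QuantumFieldTheory.Balaban1983to89
open Literature.MathematicalPhysics.QuantumFieldTheory.Balaban1983to89.T4WeightBudget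

namespace Summit.QuantumFields.BalabanUV.T4Continuum.NE7b.HealingMapClass

/-! ## §3 Remainders indexed by the PINNED COMPONENT (the refuter's F29 instantiation sentence) and the generic
summable END

PRICING-NE7b v6 F29 instantiates the defect per pinned old component: `R K t x τ :=` the part of the bad term's weight
carried by the exterior REST event `G^c(x)` of the component `x` that heals it, with the budget arriving summed over the
cover, `Σ_{x ∈ X K} Σ_{τ ∈ Badx K x} R K t x τ ≤ ρ K·Σ_{τ ∈ T K} A K t τ` (`weight(G^c(x))` bounded by (LD-G), summed over
the pinned components).  For NON-NEGATIVE `R` this is an inhabitant of `HealingLawsSetR` with the term-indexed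
remainder `rem K t τ := Σ_{x ∈ X K, τ ∈ Badx K x} R K t x τ` (every bad term collects the rests of all the components
containing it): the law survives because the collected remainder dominates each `R K t x τ`, and the budget is the
displayed one after exchanging the two sums.  The converse direction does not hold (a term-indexed remainder re-read
per component pays the cover's multiplicity), so `HealingLawsSetR` is the weaker hypothesis.  [folklore] -/

section Indexed

variable {ι α α' : Type*}
variable {l₀ : ℝ} {T : ℕ → Finset ι} {A B : ℕ → ℝ → ι → ℝ} {Bad : ℕ → ℝ → Finset ι}
  {X : ℕ → Finset α} {Badx : ℕ → α → Finset ι} {heal : ℕ → α → ι → Finset ι} {q : ℕ → α → ℝ}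
  {R : ℕ → ℝ → α → ι → ℝ} {ρ : ℕ → ℝ} {rem : ℕ → ℝ → ι → ℝ}
  {X' : ℕ → Finset α'} {Badx' : ℕ → α' → Finset ι} {heal' : ℕ → α' → ι → Finset ι} {q' : ℕ → α' → ℝ}
  {rem' : ℕ → ℝ → ι → ℝ} {ρ' : ℕ → ℝ}

/-- Exchanging the two sums of a component-indexed non-negative remainder: the COLLECTED remainder summed over the bad
class is at most the displayed double sum over the cover. [folklore] -/
theorem sum_collect_le [DecidableEq ι] (Bd : Finset ι) (Xs : Finset α) (Bx : α → Finset ι) (Rx : α → ι → ℝ)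
    (hR : ∀ x ∈ Xs, ∀ τ ∈ Bx x, 0 ≤ Rx x τ) :
    ∑ τ ∈ Bd, ∑ x ∈ Xs.filter (fun x => τ ∈ Bx x), Rx x τ ≤ ∑ x ∈ Xs, ∑ τ ∈ Bx x, Rx x τ := by
  calc ∑ τ ∈ Bd, ∑ x ∈ Xs.filter (fun x => τ ∈ Bx x), Rx x τ
        = ∑ τ ∈ Bd, ∑ x ∈ Xs, (if τ ∈ Bx x then Rx x τ else 0) := by
          refine Finset.sum_congr rfl fun τ _ => ?_
          rw [Finset.sum_filter]
    _ = ∑ x ∈ Xs, ∑ τ ∈ Bd, (if τ ∈ Bx x then Rx x τ else 0) := Finset.sum_comm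
    _ = ∑ x ∈ Xs, ∑ τ ∈ Bd.filter (fun τ => τ ∈ Bx x), Rx x τ := by
          refine Finset.sum_congr rfl fun x _ => ?_
          rw [Finset.sum_filter]
    _ ≤ ∑ x ∈ Xs, ∑ τ ∈ Bx x, Rx x τ :=
          Finset.sum_le_sum fun x hx => Finset.sum_le_sum_of_subset_of_nonneg
            (fun τ hτ => (Finset.mem_filter.mp hτ).2) fun τ hτ _ => hR x hx τ hτ

/-- **COMPONENT-INDEXED REMAINDERS INHABIT `HealingLawsSetR`** (F29's instantiation sentence).  Structural fields as in
`HealingLawsSet`; the law `A K t τ ≤ q K x·Σ_{heal K x τ} A + R K t x τ` for every pinned component `x` containing `τ`, with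
`R ≥ 0` there; the budget DISPLAYED AS IT ARRIVES, summed over the cover: `Σ_x Σ_{τ ∈ Badx K x} R ≤ ρ K·Σ_{T K} A`,
`ρ ≥ 0`.  THEN `HealingLawsSetR` holds with the collected remainder `rem K t τ := Σ_{x ∈ X K, τ ∈ Badx K x} R K t x τ` and
the same `ρ` — so `HealingLawsSetR.bad_le`, `relWeightBound_of_healingSetR` and
`exists_relWeightBound_of_healingSetR_majorant` apply verbatim. [folklore] -/
theorem HealingLawsSetR.of_indexed [DecidableEq ι]
    (bad_subset : ∀ K t, |t| ≤ l₀ → Bad K t ⊆ T K)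
    (cover : ∀ K t, |t| ≤ l₀ → ∀ τ ∈ Bad K t, ∃ x ∈ X K, τ ∈ Badx K x)
    (heal_subset : ∀ K, ∀ x ∈ X K, ∀ τ ∈ Badx K x, heal K x τ ⊆ T K)
    (heal_disjoint : ∀ K, ∀ x ∈ X K, (↑(Badx K x) : Set ι).PairwiseDisjoint (heal K x))
    (q_nonneg : ∀ K, ∀ x ∈ X K, 0 ≤ q K x)
    (le_heal : ∀ K t, |t| ≤ l₀ → ∀ x ∈ X K, ∀ τ ∈ Badx K x,
      A K t τ ≤ q K x * ∑ τ' ∈ heal K x τ, A K t τ' + R K t x τ)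
    (R_nonneg : ∀ K t, |t| ≤ l₀ → ∀ x ∈ X K, ∀ τ ∈ Badx K x, 0 ≤ R K t x τ)
    (rho_nonneg : ∀ K, 0 ≤ ρ K)
    (sum_R_le : ∀ K t, |t| ≤ l₀ →
      ∑ x ∈ X K, ∑ τ ∈ Badx K x, R K t x τ ≤ ρ K * ∑ τ ∈ T K, A K t τ) :
    HealingLawsSetR l₀ T A Bad X Badx heal q
      (fun K t τ => ∑ x ∈ (X K).filter (fun x => τ ∈ Badx K x), R K t x τ) ρ where
  bad_subset := bad_subset
  cover := cover
  heal_subset := heal_subset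
  heal_disjoint := heal_disjoint
  q_nonneg := q_nonneg
  le_heal K t ht x hx τ hτ := by
    have h1 := le_heal K t ht x hx τ hτ
    have h2 : R K t x τ ≤ ∑ x' ∈ (X K).filter (fun x' => τ ∈ Badx K x'), R K t x' τ :=
      Finset.single_le_sum (f := fun x' => R K t x' τ)
        (fun x' hx' => R_nonneg K t ht x' (Finset.mem_filter.mp hx').1 τ (Finset.mem_filter.mp hx').2)
        (Finset.mem_filter.mpr ⟨hx, hτ⟩)
    linarith
  rho_nonneg := rho_nonneg
  sum_rem_le K t ht :=
    (sum_collect_le (Bad K t) (X K) (Badx K) (fun x τ => R K t x τ) (R_nonneg K t ht)).trans (sum_R_le K t ht)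

/-- **GENERIC END: ONE SUMMABLE TOLERANCE ⟹ `RelWeightBound` FROM SOME `K₀` ON.**  Two runs' `HealingLawsSetR` over common
term sets and bad classes, non-negative weights, and ONE summable `W` dominating both total tolerances
`Σ_x q K x + ρ K` (resp. primed) at every cutoff ⟹ `W K → 0`, so `W K < 1` from some `K₀` on, and
`relWeightBound_of_healingSetR` gives the END with the bad classes emptied below that `K₀` (no two-rate shape asked of
`W`). [folklore] -/
theorem exists_relWeightBound_of_healingSetR_summable {W : ℕ → ℝ}
    (hA : HealingLawsSetR l₀ T A Bad X Badx heal q rem ρ) (hB : HealingLawsSetR l₀ T B Bad X' Badx' heal' q' rem' ρ')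
    (hA0 : ∀ K t, |t| ≤ l₀ → ∀ τ, 0 ≤ A K t τ) (hB0 : ∀ K t, |t| ≤ l₀ → ∀ τ, 0 ≤ B K t τ)
    (hWA : ∀ K, ∑ x ∈ X K, q K x + ρ K ≤ W K) (hWB : ∀ K, ∑ x ∈ X' K, q' K x + ρ' K ≤ W K) (hs : Summable W) :
    ∃ K₀ : ℕ, RelWeightBound l₀ T A B (fun K t => if K₀ ≤ K then Bad K t else ∅)
      (Set.indicator {K | K₀ ≤ K} W) := by
  obtain ⟨K₀, hK₀⟩ := Filter.eventually_atTop.mp (hs.tendsto_atTop_zero.eventually (gt_mem_nhds one_pos))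
  exact ⟨K₀, relWeightBound_of_healingSetR hA hB hA0 hB0 (fun K _ => hWA K) (fun K _ => hWB K) hK₀ hs⟩

end Indexed

end Summit.QuantumFields.BalabanUV.T4Continuum.NE7b.HealingMapClass
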